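import Literature.Probability.RandomPlanarGeometry.HexSAWPolygonCellsOmegaBase
import Literature.Probability.RandomPlanarGeometry.HexSAWPolygonCellsShift
import HarnessLib

/-!
# Cell calculus for honeycomb polygon surgery, XXXI: OMEGA keeps the bottom-left hexagon; the base of a `12`-gon has at least two hexagons

Topic `Literature/Probability/RandomPlanarGeometry` (lane «pcv-sawmu», a-p4 g22; sequel of XXX `…CellsOmegaBase` (`omegaImage`, `baseImage`, `basePort`), XXI
`…CellsShift` (`IsLexmin`), XXII `…CellsOmegaRec`, XII `…CellsStickDecomp`).

Two inputs of the final assembly (DESIGN-BRIDGE-g22 §4): ★ `isLexmin_omegaImage` — if `b` is the bottom-left hexagon of an admissible `S` then it is the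
bottom-left hexagon of `ι S` (every port lies strictly above its host — `PortRows`, propagated along the recursion like `PortInv`; every base image adds
hexagons above or right of the base's bottom-left hexagon; peeled hexagons stand on `LL`), so translation classes can be normalised at the bottom-left
hexagon BEFORE applying `ι`; and ★ `two_le_card_peel` — a set with `perim ≥ 12` has a base with at least two hexagons (a base
`{x}` forces `S ⊆ {x, UR x}`: the third hexagon of the up-right chain is never peeled, `C₂` being a base).

Sources: N. Madras, G. Slade, *The Self-Avoiding Walk* (1993), §3.2, proof of Theorem 3.2.3 [MadrasSlade1993]; I. Jensen, J. Phys.: Conf. Ser. 42 (2006) 163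
[Jensen2006HoneycombPolygons].  Label (lane): LANE INFRASTRUCTURE for the lane's step-two injection; nothing new in writing.
-/

open Finset

namespace Literature.Probability.RandomPlanarGeometry.SAW

namespace HexCell

/-! ### The base of a `12`-gon has at least two hexagons -/

/-- If the base is a single hexagon `x`, the third hexagon `UR² x` of the up-right chain is not in `S`.
[cite: MadrasSlade1993, §3.2 (proof of Theorem 3.2.3)] -/
theorem ur_ur_notMem_of_peel_eq_singleton {S : Finset Cell} {x : Cell} (hpeel : peel S = {x}) : UR (UR x) ∉ S := by
  classical
  suffices key : ∀ S' : Finset Cell, peel S' = {x} → UR (UR x) ∉ S' from key S hpeel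
  intro S'
  induction S' using Finset.strongInduction with
  | H S' ih =>
    intro hpe
    by_cases hp : ∃ m, Peelable S' m
    · obtain ⟨m, hm⟩ := hp
      have hpe' : peel (S'.erase m) = {x} := by rw [← peel_eq_peel_erase hm]; exact hpe
      have hnot := ih _ (erase_ssubset hm.mem) hpe'
      intro hmem
      by_cases e : m = UR (UR x)
      swap
      · exact hnot (mem_erase.2 ⟨Ne.symm e, hmem⟩)
      subst e
      -- `T := S'.erase (UR² x)` is `{x, UR x}`: every hexagon of `T ∖ {x}` is `UR^i x` with its whole stick in `T`, and `UR² x ∉ T`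
      have hURx : UR x ∈ S'.erase (UR (UR x)) := by
        have := hm.1.ll_mem
        rw [show LL (UR (UR x)) = UR x by ext <;> simp] at this
        exact mem_erase.2 ⟨fun h => by have := congrArg Prod.snd h; simp at this, this⟩
      have hT : S'.erase (UR (UR x)) = {x, UR x} := by
        apply Subset.antisymm
        · intro c hc
          by_cases hcx : c = x
          · simp [hcx]
          · have hcT : c ∈ S'.erase (UR (UR x)) \ peel (S'.erase (UR (UR x))) := by rw [hpe']; exact mem_sdiff.2 ⟨hc, by simpa using hcx⟩
            obtain ⟨h, i, hh, hi, hci, hseg⟩ := exists_host_stick_of_mem_sdiff_peel hcT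
            rw [hpe'] at hh
            have hhx : h = x := by simpa using hh.1
            subst hhx
            -- `i ≥ 2` would put `UR² h = urIter h 2` in the erased set
            have hi1 : i = 1 := by
              by_contra hne
              have h2 := hseg 2 (by omega) (by omega)
              rw [show urIter h 2 = UR (UR h) by rw [show (2:ℕ) = 0 + 1 + 1 from rfl, urIter_succ, urIter_succ, urIter_zero]] at h2
              exact (notMem_erase _ _) (mem_sdiff.1 h2).1
            subst hi1
            rw [← hci, urIter_succ, urIter_zero]; simp
        · intro c hc
          simp only [mem_insert, mem_singleton] at hc
          rcases hc with rfl | rfl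
          · exact mem_erase.2 ⟨fun h => by have := congrArg Prod.snd h; simp at this; omega, (peel_subset S' (by rw [hpe]; simp))⟩
          · exact hURx
      -- so `S' = C₂`, which is not peelable
      apply hm.2.2
      refine ⟨x, ?_⟩
      rw [← insert_erase hmem, hT]
      ext c; simp only [mem_insert, mem_singleton]; tauto
    · rw [peel_eq_self hp] at hpe
      rw [hpe]; simp only [mem_singleton]
      intro h; have := congrArg Prod.snd h; simp at this; omega

/-- ★ A set of hexagons with perimeter `≥ 12` has a base with at least two hexagons. [cite: MadrasSlade1993, §3.2 (proof of Theorem 3.2.3)] -/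
theorem two_le_card_peel {S : Finset Cell} (h12 : 12 ≤ perim S) : 2 ≤ #(peel S) := by
  classical
  by_contra hlt
  have hne : S.Nonempty := by
    by_contra h
    rw [not_nonempty_iff_eq_empty] at h
    rw [h, perim_empty] at h12; omega
  -- `peel S` is nonempty (the bottom-left hexagon is never peeled) hence a singleton `{x}`
  obtain ⟨b, hb⟩ := exists_isLexmin hne
  have hbP : b ∈ peel S := by
    by_contra h
    have := ll_mem_of_mem_sdiff_peel (mem_sdiff.2 ⟨hb.1, h⟩)
    exact hb.ll_notMem this
  have hcard : #(peel S) = 1 := by have := card_pos.2 ⟨b, hbP⟩; omega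
  obtain ⟨x, hx⟩ := card_eq_one.1 hcard
  have hur := ur_ur_notMem_of_peel_eq_singleton hx
  -- every other hexagon is `UR x`
  have hsub : S ⊆ {x, UR x} := by
    intro c hc
    by_cases hcx : c = x
    · simp [hcx]
    · have hcT : c ∈ S \ peel S := by rw [hx]; exact mem_sdiff.2 ⟨hc, by simpa using hcx⟩
      obtain ⟨h, i, hh, hi, hci, hseg⟩ := exists_host_stick_of_mem_sdiff_peel hcT
      rw [hx] at hh
      have hhx : h = x := by simpa using hh.1
      subst hhx
      have hi1 : i = 1 := by
        by_contra hne
        have h2 := hseg 2 (by omega) (by omega)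
        rw [show urIter h 2 = UR (UR h) by rw [show (2:ℕ) = 0 + 1 + 1 from rfl, urIter_succ, urIter_succ, urIter_zero]] at h2
        exact hur (mem_sdiff.1 h2).1
      subst hi1
      rw [← hci, urIter_succ, urIter_zero]; simp
  -- hence `perim S ≤ 10`
  have hxS : x ∈ S := peel_subset S (by rw [hx]; simp)
  have hperim : perim S ≤ 10 := by
    by_cases hu : UR x ∈ S
    · have hSeq : S = insert (UR x) {x} := by
        apply Subset.antisymm
        · intro c hc; have := hsub hc; simp only [mem_insert, mem_singleton] at this ⊢; tauto
        · intro c hc; simp only [mem_insert, mem_singleton] at hc; rcases hc with rfl | rfl; exacts [hu, hxS]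
      have hnot : UR x ∉ ({x} : Finset Cell) := by simp [Prod.ext_iff]
      have hone : #(nbrs (UR x) ∩ {x}) = 1 := by
        rw [inter_singleton_of_mem (by rw [mem_nbrs_iff]; simp [Prod.ext_iff]), card_singleton]
      have hins := perim_insert_of_contacts_eq_one hnot hone
      rw [← hSeq, perim_singleton] at hins
      omega
    · have hSeq : S = {x} := by
        apply Subset.antisymm
        · intro c hc; have := hsub hc; simp only [mem_insert, mem_singleton] at this ⊢
          rcases this with rfl | rfl
          · rfl
          · exact absurd hc hu
        · simpa using hxS
      rw [hSeq, perim_singleton]; norm_num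
  omega

/-! ### Ports lie strictly above their hosts -/

/-- `PortRows X T P`: every host `h ∉ X` has its port on a row above `h`. [cite: MadrasSlade1993, §3.2 (proof of Theorem 3.2.3)] -/
def PortRows (X T : Finset Cell) (P : Cell → Cell) : Prop := ∀ h, IsHost T h → h ∉ X → h.2 + 1 ≤ (P h).2

/-- `PortRows` survives a step of the recursion. [cite: MadrasSlade1993, §3.2 (proof of Theorem 3.2.3)] -/
theorem PortRows.step {X S : Finset Cell} {m : Cell} (hm : IsSpikeTop S m) {P : Cell → Cell} (hR : PortRows X (S.erase m) P) (hdX : LL m ∉ X) :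
    PortRows X S (Function.update P m (UR (P (LL m)))) := by
  intro h hh hX
  by_cases e : h = m
  · subst e
    rw [Function.update_self, UR_snd]
    have := hR _ (isHost_erase_ll_of_isSpikeTop hm) hdX
    simp only [LL_snd] at this; omega
  · rw [Function.update_of_ne e]; exact hR _ (hh.erase_of_ne hm e) hX

open Classical in
/-- `PortRows` for the full recursion. [cite: MadrasSlade1993, §3.2 (proof of Theorem 3.2.3)] -/
theorem portRows_omegaRec {C : Finset Cell → Finset Cell} {P₀ : Finset Cell → Cell → Cell} {X S : Finset Cell} (hX : ∀ c ∈ S \ peel S, LL c ∉ X)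
    (hbase : PortRows X (peel S) (P₀ (peel S))) : PortRows X S (omegaRec C P₀ S).2 := by
  induction S using Finset.strongInduction with
  | H S ih =>
    by_cases h : ∃ m, Peelable S m
    · obtain ⟨m, hm⟩ := h
      rw [omegaRec_eq_of_peelable hm]
      have hb' : PortRows X (peel (S.erase m)) (P₀ (peel (S.erase m))) := by rw [← peel_eq_peel_erase hm]; exact hbase
      have hX' : ∀ c ∈ S.erase m \ peel (S.erase m), LL c ∉ X := fun c hc =>
        hX c (by rw [sdiff_peel_eq_insert hm]; exact mem_insert_of_mem hc)
      have hmX : LL m ∉ X := hX m (by rw [sdiff_peel_eq_insert hm]; exact mem_insert_self _ _)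
      exact (ih _ (erase_ssubset hm.mem) hX' hb').step hm.1 hmX
    · rw [omegaRec_eq_base h]
      rw [peel_eq_self h] at hbase
      exact hbase

open Classical in
/-- Every hexagon of `ι S` outside the base image stands on a row `≥` that of a peeled hexagon of `S` (it is the re-grown copy of one).
[cite: MadrasSlade1993, §3.2 (proof of Theorem 3.2.3)] -/
theorem mem_omegaRec_cases {C : Finset Cell → Finset Cell} {P₀ : Finset Cell → Cell → Cell} {X S : Finset Cell} (hX : ∀ c ∈ S \ peel S, LL c ∉ X)
    (hbase : PortRows X (peel S) (P₀ (peel S))) {x : Cell} (hx : x ∈ (omegaRec C P₀ S).1) :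
    x ∈ C (peel S) ∨ ∃ m ∈ S \ peel S, m.2 ≤ x.2 := by
  induction S using Finset.strongInduction generalizing x with
  | H S ih =>
    by_cases h : ∃ m, Peelable S m
    · obtain ⟨m, hm⟩ := h
      have hpe := peel_eq_peel_erase hm
      have hb' : PortRows X (peel (S.erase m)) (P₀ (peel (S.erase m))) := by rw [← hpe]; exact hbase
      have hX' : ∀ c ∈ S.erase m \ peel (S.erase m), LL c ∉ X := fun c hc =>
        hX c (by rw [sdiff_peel_eq_insert hm]; exact mem_insert_of_mem hc)
      have hmX : LL m ∉ X := hX m (by rw [sdiff_peel_eq_insert hm]; exact mem_insert_self _ _)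
      rw [omegaRec_eq_of_peelable hm] at hx
      rcases mem_insert.1 hx with rfl | hx
      · right
        refine ⟨m, by rw [sdiff_peel_eq_insert hm]; exact mem_insert_self _ _, ?_⟩
        have := portRows_omegaRec (C := C) hX' hb' _ (isHost_erase_ll_of_isSpikeTop hm.1) hmX
        simp only [LL_snd] at this; omega
      · rcases ih _ (erase_ssubset hm.mem) hX' hb' hx with h1 | ⟨m', hm', hle⟩
        · left; rw [hpe]; exact h1
        · right; exact ⟨m', by rw [sdiff_peel_eq_insert hm]; exact mem_insert_of_mem hm', hle⟩
    · rw [omegaRec_eq_base h] at hx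
      left; rw [peel_eq_self h]; exact hx

open Classical in
/-- The base image is contained in `ι S`. [cite: MadrasSlade1993, §3.2 (proof of Theorem 3.2.3)] -/
theorem subset_omegaRec {C : Finset Cell → Finset Cell} {P₀ : Finset Cell → Cell → Cell} (S : Finset Cell) : C (peel S) ⊆ (omegaRec C P₀ S).1 := by
  induction S using Finset.strongInduction with
  | H S ih =>
    by_cases h : ∃ m, Peelable S m
    · obtain ⟨m, hm⟩ := h
      rw [omegaRec_eq_of_peelable hm, peel_eq_peel_erase hm]
      exact (ih _ (erase_ssubset hm.mem)).trans (subset_insert _ _)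
    · rw [omegaRec_eq_base h, peel_eq_self h]

/-! ### The bottom-left hexagon of a base and of its image -/

/-- For a base `B` (no peelable top, `#B ≥ 2`, polygonal boundary) with bottom-left hexagon `b`: `b` lies in the base image, every hexagon of the base image is
`⪰ b`, and every port lies strictly above its host. [cite: MadrasSlade1993, §3.2 (proof of Theorem 3.2.3)] -/
theorem base_lexmin {B : Finset Cell} (hB : IsBrickSet B) (hP : IsPolygon brickWallGraph (bdry B)) (h2 : 2 ≤ #B) (hfix : peel B = B) {b : Cell}
    (hb : IsLexmin B b) :
    b ∈ baseImage B ∧ (∀ x ∈ baseImage B, b.2 < x.2 ∨ (b.2 = x.2 ∧ b.1 ≤ x.1)) ∧ PortRows (baseExc B) B (basePort B) := by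
  classical
  have hne : B.Nonempty := card_pos.1 (by omega)
  have ht := isLexmax_topCell hne
  have hbt : b.2 ≤ (topCell B).2 := by rcases hb.2 _ ht.1 with h | ⟨h, -⟩ <;> omega
  rcases base_cases hB hP h2 hfix with hL | ⟨hL, hLR⟩ | ⟨hL, hLR, h3⟩ | hru
  · have eI : baseImage B = flipImage B (topCell B) := by rw [baseImage, if_pos hL]
    have eP : basePort B = portX (topCell B) := by rw [basePort, if_pos hL]
    rw [eI, eP, flipImage]
    refine ⟨mem_insert_of_mem hb.1, fun x hx => ?_, fun d _ _ => ?_⟩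
    · rcases mem_insert.1 hx with rfl | hx
      · left; simp; omega
      · exact hb.2 x hx
    · rw [portX]; split_ifs with e
      · subst e; simp
      · simp
  · have eI : baseImage B = roofImage B (topCell B) := by rw [baseImage, if_neg hL, if_pos hLR]
    have eP : basePort B = portR (topCell B) (runLen B (topCell B)) := by rw [basePort, if_neg hL, if_pos hLR]
    have hb' : b.2 ≤ (topCell B).2 - 1 := by rcases hb.2 _ hLR with h | ⟨h, -⟩ <;> simp at h ⊢ <;> omega
    rw [eI, eP, roofImage]
    refine ⟨mem_union_left _ hb.1, fun x hx => ?_, fun d _ _ => ?_⟩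
    · rcases mem_union.1 hx with hx | hx
      · exact hb.2 x hx
      · obtain ⟨i, -, rfl⟩ := mem_roof.1 hx; left; simp; omega
    · rw [portR]; split_ifs with e
      · subst e; simp
      · simp
  · have eI : baseImage B = {UL (UR (chain3Base h3)), UR (chain3Base h3), R (chain3Base h3), chain3Base h3} := by
      rw [baseImage, if_neg hL, if_neg hLR, dif_pos h3]
    have eP : basePort B = fun _ => UR (UL (UR (chain3Base h3))) := by rw [basePort, if_neg hL, if_neg hLR, dif_pos h3]
    have e := chain3Base_spec h3
    -- `b = p`
    have hbp : b = chain3Base h3 := by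
      have hbB := (Finset.ext_iff.1 e b).1 hb.1
      have hpB : chain3Base h3 ∈ B := (Finset.ext_iff.1 e _).2 (by simp)
      have hle := hb.2 _ hpB
      simp only [mem_insert, mem_singleton] at hbB
      rcases hbB with h | h | h
      · exact h
      · exfalso; rw [h] at hle; simp at hle
      · exfalso; rw [h] at hle; simp at hle; omega
    rw [eI, eP, hbp]
    refine ⟨by simp, fun x hx => ?_, fun d hd _ => ?_⟩
    · simp only [mem_insert, mem_singleton] at hx
      rcases hx with rfl | rfl | rfl | rfl <;> simp
    · have e' : ({UR (UR (chain3Base h3)), UR (chain3Base h3), chain3Base h3} : Finset Cell) = B := by rw [← chain3_eq']; exact e.symm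
      rw [← e'] at hd
      rw [eq_top_of_isHost_chain3 hd]; simp
  · obtain ⟨ht₀, hL₀, hk, hrun, hend, hll⟩ := ruSpec hru
    have h3 : ¬ IsChain3 B := hru.2.2.1
    have hL : L (topCell B) ∉ B := hru.1
    have hLR : LR (topCell B) ∉ B := hru.2.1
    -- `b` lies below the run: `e_0 ∈ B` is on row `t₀.y − 1`
    have he0 : runCell (ruTop hru) 0 ∈ B := mem_of_mem_erase (hrun 0 (by omega))
    have hb' : b.2 ≤ (ruTop hru).2 - 1 := by rcases hb.2 _ he0 with h | ⟨h, -⟩ <;> simp at h ⊢ <;> omega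
    have hbB₀ : b ∈ B.erase (topCell B) := by
      refine mem_erase.2 ⟨fun e => ?_, hb.1⟩
      have := congrArg Prod.snd hll
      rw [← e] at this; simp at this
      have ht₀row : (ruTop hru).2 ≤ (topCell B).2 := by
        rcases ht.2 _ (mem_of_mem_erase ht₀.1) with h | ⟨h, -⟩ <;> omega
      omega
    by_cases hfl : L (chainCell (ruTop hru) (chainIdx (B.erase (topCell B)) (ruTop hru))) ∈ B.erase (topCell B)
    · have eI : baseImage B = ruFlipImage (B.erase (topCell B)) (ruTop hru) (ruLen hru) := by
        rw [baseImage, if_neg hL, if_neg hLR, dif_neg h3, dif_pos hru, if_pos hfl]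
      have eP : basePort B = ruFlipPort (B.erase (topCell B)) (ruTop hru) := by
        rw [basePort, if_neg hL, if_neg hLR, dif_neg h3, dif_pos hru, if_pos hfl]
      rw [eI, eP, ruFlipImage]
      refine ⟨mem_insert_of_mem (mem_insert_of_mem hbB₀), fun x hx => ?_, fun d _ _ => ?_⟩
      · rcases mem_insert.1 hx with rfl | hx
        · left; simp; omega
        rcases mem_insert.1 hx with rfl | hx
        · left; simp; omega
        · exact hb.2 x (mem_of_mem_erase hx)
      · rw [ruFlipPort]; split_ifs <;> simp
    · have eI : baseImage B = ruLeafImage (B.erase (topCell B)) (ruTop hru) (ruLen hru) := by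
        rw [baseImage, if_neg hL, if_neg hLR, dif_neg h3, dif_pos hru, if_neg hfl]
      have eP : basePort B = ruLeafPort (B.erase (topCell B)) (ruTop hru) := by
        rw [basePort, if_neg hL, if_neg hLR, dif_neg h3, dif_pos hru, if_neg hfl]
      rw [eI, eP, ruLeafImage]
      refine ⟨mem_insert_of_mem (mem_union_left _ hbB₀), fun x hx => ?_, fun d _ _ => ?_⟩
      · rcases mem_insert.1 hx with rfl | hx
        · left; simp; omega
        rcases mem_union.1 hx with hx | hx
        · exact hb.2 x (mem_of_mem_erase hx)
        · obtain ⟨i, -, rfl⟩ := mem_roof.1 hx; left; simp; omega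
      · rw [ruLeafPort]; split_ifs <;> simp

/-- ★ **OMEGA keeps the bottom-left hexagon.** [cite: MadrasSlade1993, §3.2 (proof of Theorem 3.2.3; lane normalisation for translation classes)] -/
theorem isLexmin_omegaImage {S : Finset Cell} (hS : IsBrickSet S) (hP : IsPolygon brickWallGraph (bdry S)) (h2 : 2 ≤ #(peel S)) {b : Cell}
    (hb : IsLexmin S b) : IsLexmin (omegaImage S) b := by
  classical
  have hbB : b ∈ peel S := by
    by_contra h
    exact hb.ll_notMem (ll_mem_of_mem_sdiff_peel (mem_sdiff.2 ⟨hb.1, h⟩))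
  have hbB' : IsLexmin (peel S) b := ⟨hbB, fun c hc => hb.2 c (peel_subset S hc)⟩
  have hfix : peel (peel S) = peel S := peel_eq_self_iff.2 (not_exists_peelable_peel S)
  obtain ⟨hmem, hmin, hrows⟩ := base_lexmin (isBrickSet_peel hS) (isPolygon_bdry_peel hS hP) h2 hfix hbB'
  refine ⟨subset_omegaRec S hmem, fun x hx => ?_⟩
  rcases mem_omegaRec_cases (C := baseImage) (omega_hX hS) hrows hx with h | ⟨m, hm, hle⟩
  · exact hmin x h
  · have hll := ll_mem_of_mem_sdiff_peel hm
    have := hb.2 _ hll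
    simp only [LL_snd, LL_fst] at this
    left; omega

end HexCell

end Literature.Probability.RandomPlanarGeometry.SAW
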